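import Literature.NumberTheory.EllipticCurves.BSDSelmerPConverseYanZhuProofs
import Literature.NumberTheory.EllipticCurves.HeegnerPointsKolyvaginStructure
import Literature.NumberTheory.EllipticCurves.HeegnerPointsOfConductorGaloisConj
import Literature.NumberTheory.EllipticCurves.BSDHeegnerPoints
import Literature.NumberTheory.EllipticCurves.BSDHeegnerPointsModularityOnlyProofs
import Literature.NumberTheory.EllipticCurves.AnalyticRankModularityProofs
import Literature.NumberTheory.EllipticCurves.LeadingTermProofs
import Literature.NumberTheory.EllipticCurves.HeegnerHypothesisKroneckerProofs
import HarnessLib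

/-!
# The Yan–Zhu / BCGS rank-one `p`-converse along the printed proof: Kolyvagin's conjecture
# (BCGS, Thm. 1) + Kolyvagin's structure theorem (1991, Thm. 4) + Gross–Zagier

`Proofs` companion (theorems only: no definition, no new named fact) of
`Literature.NumberTheory.EllipticCurves.KuriharaNumberKimStructure` for the named fact
`Literature.NumberTheory.EllipticCurves.yanZhu_analyticRank_eq_one_of_selmerCorank_eq_one`
("`corank_{ℤ_p} Sel_{p^∞}(E/ℚ) = 1 ⇒ ord_{s=1} L(E, s) = 1` for `p ≥ 5` good ordinary with
`ρ̄_{E,p}` onto"; X. Yan, X. Zhu, arXiv:2412.20078, Cor. 1.4 / Thm. 4.15 (2)⇒(3) at `r = 1`;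
A. Burungale, F. Castella, G. Grossi, C. Skinner, *Non-vanishing of Kolyvagin systems and Iwasawa
theory*, Camb. J. Math. 14 (2026) = arXiv:2312.09301, Cor. 1, rank-one case, after descent).

## What this file adds to `BSDSelmerPConverseYanZhuProofs`

The earlier assemblies of the fact (`…_of_leaves`, `…_of_bcgs`) consume the `K`-level corank-one
`p`-converse of BCGS, Cor. 1 as an INLINE hypothesis (`hL`, `hBCGS`), because that statement is
not a named fact of the tree. BCGS prove their Cor. 1 (§0.1, p. 4: *"in combination with the
structure theorem of [Kolyvagin 1991] … `ord(κ^{Heeg}) = max{r⁺, r⁻} − 1` … In the rank one case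
it yields a `p`-converse to the Gross–Zagier and Kolyvagin theorem"*) from

* (K1) their **Thm. 1** — Kolyvagin's conjecture: the Heegner-point Kolyvagin system
  `{κ_n^{Heeg}}` does not vanish — the tree's named fact
  `BurungaleEtAl2026_exists_kolyvaginClass_ne_zero` (file `HeegnerPointsKolyvaginStructure`);
* (K2) **Kolyvagin's structure theorem** (V. A. Kolyvagin, *On the structure of Selmer groups*,
  Math. Ann. 291 (1991), Thm. 4; W. Zhang 2014, Thm. 11.2 (i)): at a non-zero class of MINIMAL
  depth `ν`, either `c = ν + 1 ∧ c' ≤ ν` or `c' = ν + 1 ∧ c ≤ ν`, where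
  `c = corank_{ℤ_p} Sel_{p^∞}(E/ℚ)`, `c' = corank_{ℤ_p} Sel_{p^∞}(E^{(d_K)}/ℚ)` — the tree's named
  fact `Kolyvagin1991_selmerCorank_of_kolyvaginClass_ne_zero` (same file);
* the **Gross–Zagier theorem** in the form "`ord_{s=1} L(E/K, s) = 1 ↔ y_K` non-torsion"
  (tree fact `analyticRankEK_eq_one_iff_heegner_nonTorsion`, itself reduced in the tree to
  `gross_zagier` + Modularity, `analyticRankEK_eq_one_iff_heegner_nonTorsion_of_exists_isNewformOf`)
  together with the identification `P(1) = Tr_{K[1]/K} y(1) = y_K` of Kolyvagin's bottom point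
  with the Gross–Zagier point (Gross 1991, §4; Shimura reciprocity at conductor `1`, tree fact
  `heegnerPointOfConductor_one_galoisConj`, file `HeegnerPointsOfConductorGaloisConj`).

All four are NAMED FACTS OF THE TREE (the first, second and fourth since 2026-08-17), so along
this decomposition the Yan–Zhu fact is closed modulo EXISTING named facts only — eight of them:
`p_parity` (Dokchitser–Dokchitser 2010, Thm. 1.4), `ModularForms.exists_isNewformOf` (BCDT 2001,
Thm. A), `HoffsteinLuo1997_exists_twist_L_one_ne_zero`, `kato_finite_of_L_one_ne_zero` (Kato 2004,
Cor. 14.3), (K1), (K2), `analyticRankEK_eq_one_iff_heegner_nonTorsion` (or `gross_zagier`) and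
`heegnerPointOfConductor_one_galoisConj`. None of the eight has a `_holds` today, so
`yanZhu_analyticRank_eq_one_of_selmerCorank_eq_one_holds` is not here.

## The argument (BCGS §0.1, p. 4, rank-one case; Yan–Zhu §4.6, proof of Thm. 4.15 (2)⇒(3))

Let `corank_p Sel(E/ℚ) = 1`, `p ≥ 5` good ordinary, `ρ̄_{E,p}` onto. (a) `p`-parity: `w(E) = −1`.
(b) Modularity + Hoffstein–Luo: an imaginary quadratic `K` with every `ℓ ∣ N_E` split, `p` split,
`d_K ≡ 1 (mod 8)` (so `d_K` odd, `≠ −3, −4`, `p ∤ d_K`) and `L(E^{(d_K)}, 1) ≠ 0`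
(`exists_heegnerField_split_twist_ne_zero_discr_emod_eight_of_hoffsteinLuo`). (c) Kato:
`c' = corank_p Sel(E^{(d_K)}/ℚ) = 0`. (d) `ρ̄` onto gives (irr) and (tor) `E(K)[p] = 0`
(tree theorems). (e) (K1): some class `c_M(n) ≠ 0`; take one of minimal depth `ν(n)`
(`heegnerSystem_exists_minimal_kolyvaginClass_ne_zero`, well-ordering of `ℕ`); (K2) there:
`c = ν + 1 ∧ c' ≤ ν` or `c' = ν + 1 ∧ c ≤ ν`, and with `c + c' = 1` both alternatives force
`ν = 0`, so `n = 1` and the BOTTOM class `c_M(1) ≠ 0`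
(`heegnerSystem_exists_kolyvaginClass_one_ne_zero_of_selmerCorank`). (f) `c_M(1)` is McCallum's
class of `P(1) = Σ_{σ ∈ 𝒢_1} σ y(1)`, which is `Gal(K[1]/K)`-invariant, descends to `P₀ ∈ E(K)`,
and is a Heegner point of level `N_E` by reciprocity; were `ord_{s=1} L(E/K, s) ≠ 1`, `P₀` would be
torsion (Gross–Zagier), hence `p^M`-divisible in the admissible subgroup `E(K[1])`, and the class
would vanish (Gross 1991, Prop. 4.7 (1)) — so `ord_{s=1} L(E/K, s) = 1`
(`heegnerSystem_analyticRankEK_eq_one_of_kolyvaginClass_one_ne_zero`; W. Zhang 2014, proof of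
Thm. 1.3, p. 196, read contrapositively). (g) Modularity: `ord L(E/K) = ord L(E) + ord L(E^{(d_K)})
= ord L(E) + 0`, so `ord_{s=1} L(E, s) = 1`.

Steps (e)–(f) give BCGS, Cor. 1 (rank-one case) over `K` in the surjective setting
(`burungaleEtAl2026_analyticRankEK_eq_one_of_selmerCorank_eq_one_of_kolyvaginSystem`: from
`corank_p Sel(E/K) = 1`, split as `c + c' = 1` by `selmerCorank_baseChange_quadratic_holds`).
The bottom-class lemmas of (f) are the Literature-side counterparts of the Summits stub HG of the
crux `SelmerRankLB` (`Summits/…/Theorems/SelmerRankSelmerRankLBStubHeegnerBottomTorsion.lean`,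
not importable from `Literature/`), stated for the point `P(1)` itself and read in the direction
`c_M(1) ≠ 0 ⇒ ord_{s=1} L(E/K, s) = 1` needed here.

* `yanZhu_analyticRank_eq_one_of_selmerCorank_eq_one_of_kolyvaginSystem` — the fact from the
  eight named facts (Gross–Zagier as `analyticRankEK_eq_one_iff_heegner_nonTorsion`);
* `…_of_kolyvaginSystem_of_gross_zagier` — the same with `gross_zagier` (the formula) instead;
* `…_of_kolyvaginSystem_of_rootNumber_eq_neg_one` — pointwise, from the sign onwards;
* `…_of_kolyvaginSystem_of_exists_isNewformOf` — `p`-parity and Kato replaced by Murty–Murty,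
  Gross–Zagier–Kolyvagin over `ℚ` and Dokchitser–Dokchitser's `rk_p` parity, as in
  `…_of_bcgs_of_exists_isNewformOf`.

## References

* [BurungaleEtAl2026] A. Burungale, F. Castella, G. Grossi, C. Skinner, Camb. J. Math. 14 (2026)
  = arXiv:2312.09301: Thm. 1 and Cor. 1 (§0.1, pp. 3–4).
* [Kolyvagin1991MathAnn] V. A. Kolyvagin, Math. Ann. 291 (1991) 253–259: §2, Thm. 4.
* [WZhang2014] W. Zhang, Camb. J. Math. 2 (2014): Thm. 1.2, Thm. 11.2 (i), proof of Thm. 1.3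
  (p. 196).
* [GrossLMS1991] B. H. Gross, LMS LNS 153 (1991): §1, §4 ((4.1), Prop. 4.7 (1)).
* [GrossZagier1986] B. Gross, D. Zagier, Invent. Math. 84 (1986): Thm. I.6.3 with V.§2, I.§7.
* [Darmon2004] H. Darmon, CBMS 101 (2004): Thm. 3.7.
* [YanZhu2024MainConjNonCM] X. Yan, X. Zhu, arXiv:2412.20078: Cor. 1.4, Thm. 4.15 (§4.6).
* [HoffsteinLuo1997] J. Hoffstein, W. Luo, Math. Res. Lett. 4 (1997): Theorem (pp. 435–436).
* [Kato2004Asterisque] K. Kato, Astérisque 295 (2004): Cor. 14.3.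
* [DokchitserDokchitserAnnals2010] T. and V. Dokchitser, Ann. of Math. 172 (2010): Thm. 1.4.
-/

noncomputable section

open scoped Classical

universe u

namespace Literature.NumberTheory.EllipticCurves

open ModularForms

/-! ### The bottom of the Heegner Kolyvagin system: `P(1)`, its descent to `E(K)`, and `c_M(1)` -/

/-- In a subgroup `A` on which multiplication by `n` is injective, every torsion point `P ∈ A` is
`n`-divisible inside `A`: `[n]` is an injective self-map of the finite cyclic group `ℤP ≤ A`, hence
onto (the step "`y_K` torsion and `E(K)[p] = 0` ⇒ `y_K ∈ p^M E(K)`" of W. Zhang 2014, proof of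
Thm. 1.3, p. 196). [folklore] -/
private theorem exists_mem_zsmul_eq_of_isOfFinAddOrder {M : Type*} [AddCommGroup M]
    {A : AddSubgroup M} {n : ℤ} (hAn : ∀ ⦃a : M⦄, a ∈ A → n • a = 0 → a = 0) {P : M} (hPA : P ∈ A)
    (hP : IsOfFinAddOrder P) : ∃ B ∈ A, n • B = P := by
  have hle : AddSubgroup.zmultiples P ≤ A := AddSubgroup.zmultiples_le.mpr hPA
  haveI : Finite (AddSubgroup.zmultiples P) := hP.finite_zmultiples.to_subtype
  let f : AddSubgroup.zmultiples P → AddSubgroup.zmultiples P :=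
    fun x ↦ ⟨n • (x : M), AddSubgroup.zsmul_mem _ x.2 n⟩
  have hinj : Function.Injective f := by
    intro x y hxy
    apply Subtype.ext
    have h : n • ((x : M) - y) = 0 := by
      rw [zsmul_sub, sub_eq_zero]
      exact congrArg Subtype.val hxy
    exact sub_eq_zero.mp (hAn (A.sub_mem (hle x.2) (hle y.2)) h)
  obtain ⟨B, hB⟩ := Finite.surjective_of_injective hinj ⟨P, AddSubgroup.mem_zmultiples P⟩
  exact ⟨B, hle B.2, congrArg Subtype.val hB⟩

section Bottom

variable {N : ℕ} [NeZero N] {W : WeierstrassCurve ℚ} {K : Type u} [Field K] [NumberField K]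
  {Dt : ModularParametrizationData W N} {β : ℤ} {ι : K →+* ℂ}

/-- `G_1 = Gal(K[1]/K[1])` is trivial. [folklore] -/
private theorem ringClassGalOver_one_one_eq_bot (ι : K →+* ℂ) : ringClassGalOver ι 1 1 = ⊥ := by
  rw [eq_bot_iff]
  intro σ hσ
  rw [ringClassGalOver, mem_fixingSubgroup_iff] at hσ
  rw [Subgroup.mem_bot]
  exact AlgEquiv.ext fun x ↦ hσ x x.2

/-- At conductor `1` the coset representatives `S` of `G_1 = 1` in `𝒢_1` are all of
`𝒢_1 = Gal(K[1]/K)` (Gross 1991, §4: `P_1 = Σ_{σ ∈ S} σ y_1 = Tr_{K_1/K}(y_1)`).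
[cite: GrossLMS1991, §4 (P_1 = y_K)] -/
private theorem mem_S_iff_of_conductor_one (d : KolyvaginHeegnerData Dt β ι 1)
    {g : ringClassField K ι 1 ≃ₐ[ℚ] ringClassField K ι 1} : g ∈ d.S ↔ g ∈ ringClassGal ι 1 := by
  refine ⟨d.S_subset g, fun hg ↦ ?_⟩
  obtain ⟨s, ⟨hsS, hs⟩, -⟩ := d.S_transversal g hg
  rw [ringClassGalOver_one_one_eq_bot, Subgroup.mem_bot, inv_mul_eq_one] at hs
  rwa [hs]

/-- **`P(1) = Σ_{σ ∈ 𝒢_1} σ y(1)` is fixed by `𝒢_1 = Gal(K[1]/K)`** (reindex the sum by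
`σ ↦ g σ`). [cite: GrossLMS1991, §1 (y_K = Tr y_1) and §4] -/
private theorem pointGalHom_derivedPoint_one (d : KolyvaginHeegnerData Dt β ι 1)
    {g : ringClassField K ι 1 ≃ₐ[ℚ] ringClassField K ι 1} (hg : g ∈ ringClassGal ι 1) :
    pointGalHom W (ringClassField K ι 1) g d.derivedPoint = d.derivedPoint := by
  rw [d.derivedPoint_one, map_sum]
  refine Finset.sum_nbij' (fun s ↦ g * s) (fun s ↦ g⁻¹ * s) (fun s hs ↦ ?_) (fun s hs ↦ ?_)
    (fun s _ ↦ inv_mul_cancel_left g s) (fun s _ ↦ mul_inv_cancel_left g s) (fun s _ ↦ ?_)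
  · exact (mem_S_iff_of_conductor_one d).mpr
      (mul_mem hg ((mem_S_iff_of_conductor_one d).mp hs))
  · exact (mem_S_iff_of_conductor_one d).mpr
      (mul_mem (inv_mem hg) ((mem_S_iff_of_conductor_one d).mp hs))
  · rw [map_mul]
    rfl

/-- The coordinatewise action of `σ ∈ Gal(K[n]/K)` on `E(K[n])` is that of `σ` viewed in
`Aut(K[n]/ℚ)` (`pointGalHom`). [folklore] -/
theorem pointMap_restrictScalars_eq_pointGalHom {n : ℕ}
    (σ : ringClassField K ι n ≃ₐ[K] ringClassField K ι n)
    (P : (W.baseChange (ringClassField K ι n)).toAffine.Point) :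
    WeierstrassCurve.Affine.Point.map (W' := W)
        (σ : ringClassField K ι n →ₐ[K] ringClassField K ι n) P =
      pointGalHom W (ringClassField K ι n) (σ.restrictScalars ℚ) P := by
  cases P <;> rfl

/-- **`P(1)` descends to `E(K)`**: `P(1) = Tr_{K[1]/K} y(1)` is fixed by `Gal(K[1]/K)` (`K[1]/K`
is Galois: `finiteDimensional_and_isGalois_ringClassField`), hence is the image of a point of
`E(K)` (Galois descent, `exists_map_eq_of_forall_map_galois_eq`) — *"`y_K = Tr_{K_1/K}(y_1)` in
`E(K)` … obtained by adding `y_1` to its conjugates"* (Gross 1991, §1).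
[cite: GrossLMS1991, §1 (p. 236) and §4 (P_1 = y_K)] -/
private theorem exists_map_eq_derivedPoint_one (hK : IsImaginaryQuadratic K)
    (d : KolyvaginHeegnerData Dt β ι 1) :
    ∃ P₀ : (W.baseChange K).toAffine.Point,
      WeierstrassCurve.Affine.Point.map (algebraMap K (ringClassField K ι 1)).toRatAlgHom P₀ =
        d.derivedPoint := by
  haveI := (finiteDimensional_and_isGalois_ringClassField hK ι one_ne_zero).2
  refine exists_map_eq_of_forall_map_galois_eq W fun σ ↦ ?_
  have hσ : σ.restrictScalars ℚ ∈ ringClassGal ι 1 := by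
    rw [ringClassGal, mem_fixingSubgroup_iff]
    rintro x ⟨k, hk⟩
    have hx : x = algebraMap K (ringClassField K ι 1) k := Subtype.ext hk.symm
    rw [hx, AlgEquiv.smul_def, AlgEquiv.restrictScalars_apply]
    exact σ.commutes k
  exact (pointMap_restrictScalars_eq_pointGalHom σ d.derivedPoint).trans
    (pointGalHom_derivedPoint_one d hσ)

/-- **`P(1)` descends to a Heegner point of level `N` in `E(K)`: Gross's `P_1 = Tr_{K_1/K} y_1 =
y_K ∈ E(K)`.** For `E/ℚ` elliptic (model `W`), `K` imaginary quadratic with the Heegner hypothesis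
for `N`, a parametrisation datum `Dt` at level `N`, an orientation `β`, an embedding `ι` and a
Kolyvagin–Heegner datum `d` of conductor `1`, granted Shimura reciprocity at conductor `1`
(`heegnerPointOfConductor_one_galoisConj N W K`, hypothesis `hrec`): there is a point `P₀ ∈ E(K)`
which is a Heegner point of level `N` (`IsHeegnerPoint N W K P₀`) and maps to
`P(1) = d.derivedPoint ∈ E(K[1])` under `E(K) → E(K[1])`. Proof: at conductor `1` the
representatives `S` of `G_1 = 1` are all of `𝒢_1 = Gal(K[1]/K)`, so `P(1) = Σ_{σ ∈ 𝒢_1} σ y(1)`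
is `𝒢_1`-invariant (reindex the sum) and descends to some `P₀ ∈ E(K)` (`K[1]/K` Galois,
`finiteDimensional_and_isGalois_ringClassField`; Galois descent,
`exists_map_eq_of_forall_map_galois_eq`); under `ι`, `P₀ ↦ Σ_{s ∈ S} (s y(1))_ℂ =
Σ_{Q ∈ H.reps} φ(τ_Q) = heegnerPointComplex Dt H` for a Heegner datum `H` of discriminant `d_K`
with residue `β` (`exists_heegnerDatum`), by `hrec`. (Literature-side home of the descent steps of
the Summits stub HG of crux `SelmerRankLB`, which cannot be imported here.)
[cite: GrossLMS1991, §1 (p. 236: y_K = Tr y_1) and §4 (P_1 = y_K)]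
[cite: Darmon2004, Thm. 3.7 and §3.7 (PDF pp. 44, 49)] -/
theorem heegnerSystem_exists_isHeegnerPoint_map_eq_derivedPoint_one [W.IsElliptic]
    (hrec : heegnerPointOfConductor_one_galoisConj N W K) (hK : IsImaginaryQuadratic K)
    (hH : SatisfiesHeegnerHypothesis N K) (d : KolyvaginHeegnerData Dt β ι 1) :
    ∃ P₀ : (W.baseChange K).toAffine.Point, IsHeegnerPoint N W K P₀ ∧
      WeierstrassCurve.Affine.Point.map (algebraMap K (ringClassField K ι 1)).toRatAlgHom P₀ =
        d.derivedPoint := by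
  obtain ⟨P₀, hP₀⟩ := exists_map_eq_derivedPoint_one hK d
  refine ⟨P₀, ?_, hP₀⟩
  obtain ⟨H, hHβ⟩ := exists_heegnerDatum N hK.discr_neg d.dvd_sq_sub
  obtain ⟨e, he⟩ := hrec hK hH Dt β ι d H hHβ
  refine ⟨Dt, H, ι, ?_⟩
  have hι : ι.toRatAlgHom = (ringClassField K ι 1).subtype.toRatAlgHom.comp
      (algebraMap K (ringClassField K ι 1)).toRatAlgHom := by
    ext x
    rfl
  rw [hι, ← WeierstrassCurve.Affine.Point.map_map, hP₀, d.derivedPoint_one, map_sum,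
    heegnerPointComplex, ← Finset.sum_coe_sort H.reps, ← Finset.sum_coe_sort d.S]
  exact Fintype.sum_equiv e _ _ fun s ↦ he s

/-- **A torsion `P(n)` has vanishing class `c_M(n)`** (Gross 1991, Prop. 4.7 (1); McCallum 1991,
Cor. 4.5: *"`c_M(n) = 0` if and only if `P_n ∈ p^M E(K_n)`"*; W. Zhang 2014, proof of Thm. 1.3,
p. 196): on the admissible branch of `kolyvaginClass` (`[p^M]` injective on `A = E(K[n]) ⊆ E(K̄)`)
a torsion `P(n) ∈ A` is `p^M`-divisible in `A` (`[p^M]` is an injective self-map of the finite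
group `ℤP(n)`, hence onto),
so McCallum's class vanishes (`KolyvaginCocycle.cls_eq_zero_of_mem`); off it the class is `0` by
definition. [cite: GrossLMS1991, Prop. 4.7 (1)] [cite: WZhang2014, proof of Thm. 1.3 (p. 196)] -/
theorem heegnerSystem_kolyvaginClass_eq_zero_of_isOfFinAddOrder {n : ℕ}
    (d : KolyvaginHeegnerData Dt β ι n) {p : ℕ} (hp : p.Prime) (M : ℕ)
    (hfin : IsOfFinAddOrder d.derivedPoint) : d.kolyvaginClass hp M = 0 := by
  have hfin' : IsOfFinAddOrder (d.toGeomPoints d.derivedPoint) :=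
    d.toGeomPoints.isOfFinAddOrder hfin
  rw [KolyvaginHeegnerData.kolyvaginClass]
  split_ifs with h
  · obtain ⟨B, hBA, hB⟩ := exists_mem_zsmul_eq_of_isOfFinAddOrder
      h.1.eq_zero_of_zsmul (AddMonoidHom.mem_range.mpr ⟨d.derivedPoint, rfl⟩) hfin'
    rw [kolyvaginClass_eq_cls h.1 h.2 hB]
    exact KolyvaginCocycle.cls_eq_zero_of_mem h.1 _ h.2 hB ⟨B, hBA, hB⟩
  · rfl

/-- **The bottom class reads the analytic rank over `K`: `c_M(1) ≠ 0 ⇒ ord_{s=1} L(E/K, s) = 1`**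
(Gross–Zagier 1986, Thm. I.6.3 with V.§2, via Gross 1991, (1.1) and §4 `P_1 = y_K`; W. Zhang
2014, proof of Thm. 1.3, p. 196, read contrapositively). Granted the Gross–Zagier corollary
`analyticRankEK_eq_one_iff_heegner_nonTorsion W N K` (`hGZ`) and Shimura reciprocity at conductor
`1` (`hrec`), for an elliptic globally minimal `W/ℚ` of conductor `N`, an imaginary quadratic `K`
with the Heegner hypothesis for `N`, and a Kolyvagin–Heegner datum `d` of conductor `1`: if some
class `c_M(1) = d.kolyvaginClass hp M` is non-zero, then `ord_{s=1} L(E/K, s) = 1`. Proof: `P(1)`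
descends to a Heegner point `P₀ ∈ E(K)` of level `N`
(`heegnerSystem_exists_isHeegnerPoint_map_eq_derivedPoint_one`);
if `ord_{s=1} L(E/K, s) ≠ 1` then `P₀`, hence `P(1)`, is torsion (`hGZ`), and the class vanishes
(`heegnerSystem_kolyvaginClass_eq_zero_of_isOfFinAddOrder`).
[cite: GrossZagier1986, Thm. I.6.3 with V.§2] [cite: GrossLMS1991, §4 (4.1), Prop. 4.7 (1)]
[cite: WZhang2014, proof of Thm. 1.3 (p. 196)] -/
theorem heegnerSystem_analyticRankEK_eq_one_of_kolyvaginClass_one_ne_zero [W.IsElliptic]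
    [W.IsGloballyMinimal] (hGZ : analyticRankEK_eq_one_iff_heegner_nonTorsion W N K)
    (hrec : heegnerPointOfConductor_one_galoisConj N W K) (hK : IsImaginaryQuadratic K)
    (hN : W.conductorNorm ℤ = N) (hH : SatisfiesHeegnerHypothesis N K)
    (d : KolyvaginHeegnerData Dt β ι 1) {p : ℕ} {hp : p.Prime} {M : ℕ}
    (hne : d.kolyvaginClass hp M ≠ 0) : analyticRankEK W K = 1 := by
  obtain ⟨P₀, hheeg, hP₀⟩ := heegnerSystem_exists_isHeegnerPoint_map_eq_derivedPoint_one hrec hK hH d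
  by_contra hne1
  have htors : IsOfFinAddOrder P₀ := by
    by_contra hnt
    exact hne1 ((hGZ hK hN hH hheeg).mpr hnt)
  have hfin : IsOfFinAddOrder d.derivedPoint := by
    rw [← hP₀]
    exact (WeierstrassCurve.Affine.Point.map (W' := W)
      (algebraMap K (ringClassField K ι 1)).toRatAlgHom).isOfFinAddOrder htors
  exact hne (heegnerSystem_kolyvaginClass_eq_zero_of_isOfFinAddOrder d hp M hfin)

end Bottom

/-! ### Kolyvagin's conjecture and structure theorem at corank one: the bottom class is non-zero -/

/-- **A non-zero class of minimal depth.** From any non-zero class `c_M(n)` of the Heegner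
Kolyvagin system (fixed `Dt`, `β`, `ι`; `n` a square-free product of Kolyvagin primes,
`1 ≤ M ≤ M(n)`) one obtains a non-zero class `c_{M₀}(n₀)` whose depth `ν(n₀) = #{ℓ ∣ n₀}` is
minimal among all non-zero classes of the system — the order of vanishing `ord κ^∞` of Kolyvagin
1991, §2 / W. Zhang 2014, p. 194 (well-ordering of `ℕ`). [folklore] -/
theorem heegnerSystem_exists_minimal_kolyvaginClass_ne_zero {W : WeierstrassCurve ℚ}
    [W.IsGloballyMinimal] [NeZero (W.conductorNorm ℤ)] {K : Type u} [Field K] [NumberField K]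
    {p : ℕ} (hp : p.Prime) {Dt : ModularParametrizationData W (W.conductorNorm ℤ)} {β : ℤ}
    {ι : K →+* ℂ} {n : ℕ} (d : KolyvaginHeegnerData Dt β ι n) {M : ℕ}
    (hn : KolyvaginDescent.KolSupp (Zhang2014.IsKolyvaginPrime (W.conductorNorm ℤ) W K p) n)
    (hM : 1 ≤ M) (hMle : (M : ℕ∞) ≤ Zhang2014.levelIndex W p n)
    (hne : d.kolyvaginClass hp M ≠ 0) :
    ∃ (n₀ : ℕ) (d₀ : KolyvaginHeegnerData Dt β ι n₀) (M₀ : ℕ),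
      KolyvaginDescent.KolSupp (Zhang2014.IsKolyvaginPrime (W.conductorNorm ℤ) W K p) n₀ ∧
        1 ≤ M₀ ∧ (M₀ : ℕ∞) ≤ Zhang2014.levelIndex W p n₀ ∧ d₀.kolyvaginClass hp M₀ ≠ 0 ∧
        ∀ (n' : ℕ) (d' : KolyvaginHeegnerData Dt β ι n') (M' : ℕ),
          KolyvaginDescent.KolSupp (Zhang2014.IsKolyvaginPrime (W.conductorNorm ℤ) W K p) n' →
          1 ≤ M' → (M' : ℕ∞) ≤ Zhang2014.levelIndex W p n' → d'.kolyvaginClass hp M' ≠ 0 →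
          n₀.primeFactors.card ≤ n'.primeFactors.card := by
  let P : ℕ → Prop := fun k ↦ ∃ (n' : ℕ) (d' : KolyvaginHeegnerData Dt β ι n') (M' : ℕ),
    KolyvaginDescent.KolSupp (Zhang2014.IsKolyvaginPrime (W.conductorNorm ℤ) W K p) n' ∧
      1 ≤ M' ∧ (M' : ℕ∞) ≤ Zhang2014.levelIndex W p n' ∧ d'.kolyvaginClass hp M' ≠ 0 ∧
      n'.primeFactors.card = k
  have hex : ∃ k, P k := ⟨_, n, d, M, hn, hM, hMle, hne, rfl⟩
  obtain ⟨n₀, d₀, M₀, hn₀, hM₀, hM₀le, hne₀, hk₀⟩ := Nat.find_spec hex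
  refine ⟨n₀, d₀, M₀, hn₀, hM₀, hM₀le, hne₀, fun n' d' M' hn' hM' hM'le hne' ↦ ?_⟩
  rw [hk₀]
  exact Nat.find_min' hex ⟨n', d', M', hn', hM', hM'le, hne', rfl⟩

/-- **Kolyvagin's conjecture (BCGS 2026, Thm. 1) + Kolyvagin's structure theorem (1991, Thm. 4)
when `corank_p Sel(E/ℚ) + corank_p Sel(E^{(d_K)}/ℚ) = 1`: the BOTTOM class `c_M(1)` is non-zero
for some datum of conductor `1`.** For `W/ℚ` globally minimal elliptic, `p ≥ 5` good ordinary
with `ρ̄_{E,p}` onto, `K` imaginary quadratic with the Heegner hypothesis for `N_E`, `d_K` odd,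
`d_K ≠ −3` and `p` split in `K`: by (K1) (`hK1`, BCGS Thm. 1, whose hypotheses (irr) and (tor)
`E(K)[p] = 0` follow from surjectivity, `hasIrreducibleModPGaloisRep_of_hasSurjectiveModNGaloisRep`,
`torsionBy_eq_bot_of_isImaginaryQuadratic`) some `c_M(n) ≠ 0`; at a non-zero class of minimal
depth `ν` (`heegnerSystem_exists_minimal_kolyvaginClass_ne_zero`) the structure theorem (K2)
(`hK2`; its hypotheses `d_K ≠ −4`, `p ∤ d_K`, `p ∤ N_E` follow from `d_K` odd, `p` split and good
reduction) gives `c = ν + 1 ∧ c' ≤ ν` or `c' = ν + 1 ∧ c ≤ ν`; with `c + c' = 1` either way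
`ν = 0`, i.e. `n = 1` (`n` square-free). This is the step *"`ord(κ^{Heeg}) = max{r⁺, r⁻} − 1` … in
the rank one case"* of BCGS, §0.1, p. 4. [cite: BurungaleEtAl2026, Thm. 1 and Cor. 1 (arXiv:2312.09301, §0.1, pp. 3–4)]
[cite: Kolyvagin1991MathAnn, §2 Thm. 4] [cite: WZhang2014, Thm. 1.2 and Thm. 11.2 (i)] -/
theorem heegnerSystem_exists_kolyvaginClass_one_ne_zero_of_selmerCorank
    (hK1 : BurungaleEtAl2026_exists_kolyvaginClass_ne_zero)
    (hK2 : Kolyvagin1991_selmerCorank_of_kolyvaginClass_ne_zero)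
    (W : WeierstrassCurve ℚ) [W.IsElliptic] [W.IsGloballyMinimal] (p : ℕ) [hp : Fact p.Prime]
    (hp5 : 5 ≤ p) (hgood : W.HasGoodReductionAtPrime p) (hord : ¬ (p : ℤ) ∣ W.frobeniusTrace p)
    (hsurj : W.HasSurjectiveModNGaloisRep p) (K : Type) [Field K] [NumberField K]
    (hK : IsImaginaryQuadratic K) [NeZero (W.conductorNorm ℤ)]
    (hHN : SatisfiesHeegnerHypothesis (W.conductorNorm ℤ) K) (hodd : Odd (NumberField.discr K))
    (hne3 : NumberField.discr K ≠ -3) (hHp : SatisfiesHeegnerHypothesis p K)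
    (hcc : W.selmerCorank p + (W.quadraticTwist (NumberField.discr K : ℚ)).selmerCorank p = 1) :
    ∃ (Dt : ModularParametrizationData W (W.conductorNorm ℤ)) (β : ℤ) (ι : K →+* ℂ)
      (d : KolyvaginHeegnerData Dt β ι 1) (M : ℕ), 1 ≤ M ∧ d.kolyvaginClass hp.out M ≠ 0 := by
  have hpP : p.Prime := hp.out
  -- the hypotheses of (K1) and (K2) from surjectivity, `d_K` odd, `p` split, good reduction
  haveI : NeZero (p : ℚ) := ⟨by exact_mod_cast hpP.ne_zero⟩
  have hirr : W.HasIrreducibleModPGaloisRep p :=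
    hasIrreducibleModPGaloisRep_of_hasSurjectiveModNGaloisRep W p hsurj
  have htor : AddSubgroup.torsionBy (W.baseChange K).toAffine.Point (p : ℤ) = ⊥ :=
    torsionBy_eq_bot_of_isImaginaryQuadratic W K hK hpP (by omega) hsurj
  have hne4 : NumberField.discr K ≠ -4 := by
    have := Int.odd_iff.mp hodd
    omega
  have hpd : ¬ ((p : ℤ) ∣ NumberField.discr K) :=
    Literature.SatisfiesHeegnerHypothesis.not_dvd_discr hK.1 hHp hpP dvd_rfl
  have hpN : ¬ (p ∣ W.conductorNorm ℤ) := not_dvd_conductorNorm_of_hasGoodReductionAtPrime W hgood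
  -- (K1): a non-zero class; minimise its depth
  obtain ⟨Dt, β, ι, n, d, M, hn, hM1, hMle, hne⟩ :=
    hK1 W p (by omega) hgood hord hirr K hK hHN hodd hne3 htor hHp
  obtain ⟨n₀, d₀, M₀, hn₀, hM₀, hM₀le, hne₀, hmin⟩ :=
    heegnerSystem_exists_minimal_kolyvaginClass_ne_zero hp.out d hn hM1 hMle hne
  -- (K2): the dichotomy at the minimal class forces depth `0`
  have hstruct := hK2 W p hp5 hsurj K hK hne3 hne4 hpd hpN hHN Dt β ι n₀ d₀ M₀ hn₀ hM₀ hM₀le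
    hne₀ hmin
  have hν : n₀.primeFactors.card = 0 := by
    rcases hstruct with ⟨h1, h2, -⟩ | ⟨h1, h2, -⟩ <;> omega
  have hn1 : n₀ = 1 := by
    rw [Finset.card_eq_zero, Nat.primeFactors_eq_empty] at hν
    rcases hν with h0 | h1
    · exact absurd (h0 ▸ hn₀.1) not_squarefree_zero
    · exact h1
  subst hn1
  exact ⟨Dt, β, ι, d₀, M₀, hM₀, hne₀⟩

/-! ### BCGS, Cor. 1 (rank-one case) over `K`, in the surjective setting -/

/-- **Burungale–Castella–Grossi–Skinner 2026, Cor. 1, rank-one case — `corank_{ℤ_p} Sel_{p^∞}(E/K)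
= 1 ⟹ ord_{s=1} L(E/K, s) = 1` — from their Thm. 1 (K1), Kolyvagin's structure theorem (K2),
Gross–Zagier and Shimura reciprocity at conductor `1`, for `ρ̄_{E,p}` onto.** Setting: `W/ℚ`
globally minimal elliptic, `p ≥ 5` good ordinary with `ρ̄_{E,p}` surjective (so (irr), (tor)),
`K` imaginary quadratic with (Heeg) for `N_E`, (disc) `d_K` odd `≠ −3`, `p` split. Proof (BCGS
§0.1, p. 4): `corank_p Sel(E/K) = c + c'` (`selmerCorank_baseChange_quadratic_holds`,
Dokchitser–Dokchitser 2010, Lem. 4.14) `= 1`; the bottom class `c_M(1) ≠ 0`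
(`heegnerSystem_exists_kolyvaginClass_one_ne_zero_of_selmerCorank`); hence
`ord_{s=1} L(E/K, s) = 1` (`heegnerSystem_analyticRankEK_eq_one_of_kolyvaginClass_one_ne_zero`).
Weaker than print ((irr) strengthened to surjectivity, as Kolyvagin 1991 requires `p ∈ B(E)`).
[cite: BurungaleEtAl2026, Thm. 1 and Cor. 1 (arXiv:2312.09301, §0.1, pp. 3–4)]
[cite: Kolyvagin1991MathAnn, §2 Thm. 4] [cite: GrossZagier1986, Thm. I.6.3 with V.§2] -/
theorem burungaleEtAl2026_analyticRankEK_eq_one_of_selmerCorank_eq_one_of_kolyvaginSystem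
    (hK1 : BurungaleEtAl2026_exists_kolyvaginClass_ne_zero)
    (hK2 : Kolyvagin1991_selmerCorank_of_kolyvaginClass_ne_zero)
    (hGZ : ∀ (W : WeierstrassCurve ℚ) (N : ℕ) [NeZero N] (K : Type) [Field K] [NumberField K],
      analyticRankEK_eq_one_iff_heegner_nonTorsion W N K)
    (hrec : ∀ (N : ℕ) [NeZero N] (W : WeierstrassCurve ℚ) (K : Type) [Field K] [NumberField K],
      heegnerPointOfConductor_one_galoisConj N W K)
    (W : WeierstrassCurve ℚ) [W.IsElliptic] [W.IsGloballyMinimal] (p : ℕ) [Fact p.Prime]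
    (hp5 : 5 ≤ p) (hgood : W.HasGoodReductionAtPrime p) (hord : ¬ (p : ℤ) ∣ W.frobeniusTrace p)
    (hsurj : W.HasSurjectiveModNGaloisRep p) (K : Type) [Field K] [NumberField K]
    (hK : IsImaginaryQuadratic K) (hHN : SatisfiesHeegnerHypothesis (W.conductorNorm ℤ) K)
    (hodd : Odd (NumberField.discr K)) (hne3 : NumberField.discr K ≠ -3)
    (hHp : SatisfiesHeegnerHypothesis p K) (hcK : (W.baseChange K).selmerCorank p = 1) :
    analyticRankEK W K = 1 := by
  haveI : NeZero (W.conductorNorm ℤ) := ⟨(W.conductorNorm_pos_holds).ne'⟩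
  have hcc : W.selmerCorank p + (W.quadraticTwist (NumberField.discr K : ℚ)).selmerCorank p = 1 := by
    rw [← selmerCorank_baseChange_quadratic_holds W K hK.1 p]
    exact hcK
  obtain ⟨Dt, β, ι, d, M, -, hne⟩ :=
    heegnerSystem_exists_kolyvaginClass_one_ne_zero_of_selmerCorank hK1 hK2 W p hp5 hgood hord
      hsurj K hK hHN hodd hne3 hHp hcc
  exact heegnerSystem_analyticRankEK_eq_one_of_kolyvaginClass_one_ne_zero (hGZ W _ K) (hrec _ W K)
    hK rfl hHN d hne

/-! ### The Yan–Zhu fact from the eight named facts -/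

/-- **Yan–Zhu (2) ⇒ (3), `r = 1`, from the sign onwards, along the printed proof of BCGS Cor. 1.**
Inputs: the Modularity Theorem (`hmod`: continuation, Artin factorisation, the auxiliary field),
Hoffstein–Luo 1997 (`hHL`), Kato's finiteness theorem (`hKato`), BCGS Thm. 1 (`hK1`), Kolyvagin's
structure theorem (`hK2`), the Gross–Zagier corollary over `K` (`hGZ`) and Shimura reciprocity at
conductor `1` (`hrec`). For the curve in hand (`p ≥ 5` good ordinary, `ρ̄_{E,p}` onto,
`w(E) = −1`, corank `1`): `K` from
`exists_heegnerField_split_twist_ne_zero_discr_emod_eight_of_hoffsteinLuo` ((Heeg), `p` split,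
`d_K ≡ 1 (mod 8)`, `L(E^{(d_K)}, 1) ≠ 0`); Kato: `c' = 0`, so `corank_p Sel(E/K) = 1 + 0`; BCGS
Cor. 1 over `K` (`burungaleEtAl2026_analyticRankEK_eq_one_of_selmerCorank_eq_one_of_kolyvaginSystem`):
`ord L(E/K) = 1 = ord L(E) + ord L(E^{(d_K)}) = ord L(E) + 0`.
[cite: BurungaleEtAl2026, Thm. 1 and Cor. 1 (arXiv:2312.09301, §0.1, pp. 3–4)]
[cite: YanZhu2024MainConjNonCM, Thm. 4.15 (proof, §4.6)]
[cite: HoffsteinLuo1997, Theorem (§1, pp. 435–436)] [cite: Kato2004Asterisque, Cor. 14.3] -/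
theorem yanZhu_analyticRank_eq_one_of_selmerCorank_eq_one_of_kolyvaginSystem_of_rootNumber_eq_neg_one
    (hmod : ModularForms.exists_isNewformOf) (hHL : HoffsteinLuo1997_exists_twist_L_one_ne_zero)
    (hKato : ∀ (W : WeierstrassCurve ℚ) [W.IsElliptic] (p : ℕ) [Fact p.Prime],
      kato_finite_of_L_one_ne_zero W p)
    (hK1 : BurungaleEtAl2026_exists_kolyvaginClass_ne_zero)
    (hK2 : Kolyvagin1991_selmerCorank_of_kolyvaginClass_ne_zero)
    (hGZ : ∀ (W : WeierstrassCurve ℚ) (N : ℕ) [NeZero N] (K : Type) [Field K] [NumberField K],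
      analyticRankEK_eq_one_iff_heegner_nonTorsion W N K)
    (hrec : ∀ (N : ℕ) [NeZero N] (W : WeierstrassCurve ℚ) (K : Type) [Field K] [NumberField K],
      heegnerPointOfConductor_one_galoisConj N W K)
    (W : WeierstrassCurve ℚ) [W.IsElliptic] [W.IsGloballyMinimal] (p : ℕ) [Fact p.Prime]
    (hp5 : 5 ≤ p) (hgood : W.HasGoodReductionAtPrime p) (hord : ¬ (p : ℤ) ∣ W.frobeniusTrace p)
    (hsurj : W.HasSurjectiveModNGaloisRep p) (hw : W.rootNumber = -1)
    (hcorank : W.selmerCorank p = 1) : W.analyticRank = 1 := by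
  have hpP : p.Prime := Fact.out
  -- (b) the auxiliary imaginary quadratic field, from Hoffstein–Luo, with `d_K ≡ 1 (mod 8)`
  obtain ⟨K, _, _, hK, -, hHN, hHp, hd8, hL1⟩ :=
    exists_heegnerField_split_twist_ne_zero_discr_emod_eight_of_hoffsteinLuo hmod hHL W hw hpP 0
  -- (disc): `d_K` odd and `d_K ≠ -3`
  have hodd : Odd (NumberField.discr K) := Int.odd_iff.mpr (by omega)
  have hne3 : NumberField.discr K ≠ -3 := by omega
  -- (c) Kato: the `p^∞`-Selmer group of the twist is finite, hence of corank `0`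
  have hd : (NumberField.discr K : ℚ) ≠ 0 := by exact_mod_cast NumberField.discr_ne_zero K
  haveI := W.isElliptic_quadraticTwist hd
  obtain ⟨-, -, hfin⟩ := hKato (W.quadraticTwist (NumberField.discr K : ℚ)) p hL1
  haveI := hfin
  have h0 : (W.quadraticTwist (NumberField.discr K : ℚ)).selmerCorank p = 0 :=
    (W.quadraticTwist (NumberField.discr K : ℚ)).selmerCorank_eq_zero_of_finite p
  -- (d) the corank over `K` is `1 + 0 = 1`
  have hcK : (W.baseChange K).selmerCorank p = 1 := by
    rw [selmerCorank_baseChange_quadratic_holds W K hK.1 p, hcorank, h0]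
  -- (e)–(f) BCGS Cor. 1 over this `K`: Thm. 1 + structure theorem + Gross–Zagier
  have hEK : analyticRankEK W K = 1 :=
    burungaleEtAl2026_analyticRankEK_eq_one_of_selmerCorank_eq_one_of_kolyvaginSystem hK1 hK2 hGZ
      hrec W p hp5 hgood hord hsurj K hK hHN hodd hne3 hHp hcK
  -- (g) factorisation of the analytic rank over `K`
  rw [analyticRankEK_eq_add_of (WeierstrassCurve.hasEntireLFunction_rat_of_exists_isNewformOf hmod)
      W K,
    analyticRank_eq_zero_of_entireLFunction_one_ne_zero _ hL1, add_zero] at hEK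
  exact hEK

/-- **Yan–Zhu, Cor. 1.4 in the tree's form (the named fact
`yanZhu_analyticRank_eq_one_of_selmerCorank_eq_one`), along the printed proof of BCGS Cor. 1,
from EIGHT NAMED FACTS of the tree**: the `p`-parity theorem (`hpar`, `p_parity`:
`w(E) = (−1)^{corank} = −1`), the Modularity Theorem (`hmod`, `ModularForms.exists_isNewformOf`),
Hoffstein–Luo 1997 (`hHL`), Kato's finiteness theorem (`hKato`, `kato_finite_of_L_one_ne_zero`),
BCGS Thm. 1 (`hK1`, `BurungaleEtAl2026_exists_kolyvaginClass_ne_zero`), Kolyvagin 1991 Thm. 4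
(`hK2`, `Kolyvagin1991_selmerCorank_of_kolyvaginClass_ne_zero`), the Gross–Zagier corollary over
`K` (`hGZ`, `analyticRankEK_eq_one_iff_heegner_nonTorsion`) and Shimura reciprocity at conductor
`1` (`hrec`, `heegnerPointOfConductor_one_galoisConj`). Relative to
`yanZhu_analyticRank_eq_one_of_selmerCorank_eq_one_of_bcgs` the inline `K`-level leaf `hBCGS` is
replaced by its printed proof from (K1), (K2) and Gross–Zagier.
[cite: BurungaleEtAl2026, Thm. 1 and Cor. 1 (arXiv:2312.09301, §0.1, pp. 3–4)]
[cite: YanZhu2024MainConjNonCM, Cor. 1.4 and Thm. 4.15 (proof, §4.6)]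
[cite: Kolyvagin1991MathAnn, §2 Thm. 4] [cite: DokchitserDokchitserAnnals2010, Thm. 1.4] -/
theorem yanZhu_analyticRank_eq_one_of_selmerCorank_eq_one_of_kolyvaginSystem
    (hpar : ∀ (W : WeierstrassCurve ℚ) [W.IsElliptic] (p : ℕ) [Fact p.Prime], p_parity W p)
    (hmod : ModularForms.exists_isNewformOf) (hHL : HoffsteinLuo1997_exists_twist_L_one_ne_zero)
    (hKato : ∀ (W : WeierstrassCurve ℚ) [W.IsElliptic] (p : ℕ) [Fact p.Prime],
      kato_finite_of_L_one_ne_zero W p)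
    (hK1 : BurungaleEtAl2026_exists_kolyvaginClass_ne_zero)
    (hK2 : Kolyvagin1991_selmerCorank_of_kolyvaginClass_ne_zero)
    (hGZ : ∀ (W : WeierstrassCurve ℚ) (N : ℕ) [NeZero N] (K : Type) [Field K] [NumberField K],
      analyticRankEK_eq_one_iff_heegner_nonTorsion W N K)
    (hrec : ∀ (N : ℕ) [NeZero N] (W : WeierstrassCurve ℚ) (K : Type) [Field K] [NumberField K],
      heegnerPointOfConductor_one_galoisConj N W K) :
    yanZhu_analyticRank_eq_one_of_selmerCorank_eq_one := by
  intro W _ _ p _ hp5 hgood hord hsurj hcorank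
  -- (a) parity: the root number is `-1`
  have hw : W.rootNumber = -1 := by
    have h := hpar W p
    unfold p_parity at h
    rw [hcorank, pow_one] at h
    exact h.symm
  exact yanZhu_analyticRank_eq_one_of_selmerCorank_eq_one_of_kolyvaginSystem_of_rootNumber_eq_neg_one
    hmod hHL hKato hK1 hK2 hGZ hrec W p hp5 hgood hord hsurj hw hcorank

/-- **The same with the Gross–Zagier FORMULA as the leaf**: `gross_zagier N W K` (Gross–Zagier
1986, Thm. I.6.3; Cai–Shu–Tian 2014, Thm. 1.1) and Modularity give the corollary
`analyticRankEK_eq_one_iff_heegner_nonTorsion W N K` by the tree's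
`analyticRankEK_eq_one_iff_heegner_nonTorsion_of_exists_isNewformOf`. So the Yan–Zhu fact rests
on exactly: `p_parity`, Modularity, Hoffstein–Luo, Kato, BCGS Thm. 1, Kolyvagin 1991 Thm. 4,
the Gross–Zagier formula, Shimura reciprocity at conductor `1`.
[cite: BurungaleEtAl2026, Thm. 1 and Cor. 1 (arXiv:2312.09301, §0.1, pp. 3–4)]
[cite: GrossZagier1986, Thm. I.6.3 with V.§2] [cite: YanZhu2024MainConjNonCM, Cor. 1.4] -/
theorem yanZhu_analyticRank_eq_one_of_selmerCorank_eq_one_of_kolyvaginSystem_of_gross_zagier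
    (hpar : ∀ (W : WeierstrassCurve ℚ) [W.IsElliptic] (p : ℕ) [Fact p.Prime], p_parity W p)
    (hmod : ModularForms.exists_isNewformOf) (hHL : HoffsteinLuo1997_exists_twist_L_one_ne_zero)
    (hKato : ∀ (W : WeierstrassCurve ℚ) [W.IsElliptic] (p : ℕ) [Fact p.Prime],
      kato_finite_of_L_one_ne_zero W p)
    (hK1 : BurungaleEtAl2026_exists_kolyvaginClass_ne_zero)
    (hK2 : Kolyvagin1991_selmerCorank_of_kolyvaginClass_ne_zero)
    (hGZ : ∀ (N : ℕ) [NeZero N] (W : WeierstrassCurve ℚ) (K : Type) [Field K] [NumberField K],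
      gross_zagier N W K)
    (hrec : ∀ (N : ℕ) [NeZero N] (W : WeierstrassCurve ℚ) (K : Type) [Field K] [NumberField K],
      heegnerPointOfConductor_one_galoisConj N W K) :
    yanZhu_analyticRank_eq_one_of_selmerCorank_eq_one :=
  yanZhu_analyticRank_eq_one_of_selmerCorank_eq_one_of_kolyvaginSystem hpar hmod hHL hKato hK1 hK2
    (fun W N _ K _ _ ↦
      analyticRankEK_eq_one_iff_heegner_nonTorsion_of_exists_isNewformOf W N K (hGZ N W K) hmod)
    hrec

/-- **The same over the leaf set of `…_of_bcgs_of_exists_isNewformOf`**: `p`-parity and Kato are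
replaced by Murty–Murty (`hMM`), Gross–Zagier–Kolyvagin over `ℚ` (`hGZK`,
`rank_eq_analyticRank_of_analyticRank_le_one`, which yields Kato's finiteness,
`kato_finite_of_L_one_ne_zero_of_rank_eq_analyticRank`) and Dokchitser–Dokchitser's `rk_p` parity
(`hDD`), which give the sign `w(E) = −1` (`rootNumber_eq_neg_one_of_selmerCorank_eq_one_of_facts`).
So along this road the Yan–Zhu fact rests on: Modularity, Hoffstein–Luo, Murty–Murty, GZK over
`ℚ`, `rk_p` parity, BCGS Thm. 1, Kolyvagin 1991 Thm. 4, the Gross–Zagier formula, reciprocity.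
[cite: BurungaleEtAl2026, Thm. 1 and Cor. 1 (arXiv:2312.09301, §0.1, pp. 3–4)]
[cite: YanZhu2024MainConjNonCM, Cor. 1.4 and Thm. 4.15 (proof, §4.6)]
[cite: DokchitserDokchitserAnnals2010, Thm. 1.4 and §4.6] -/
theorem yanZhu_analyticRank_eq_one_of_selmerCorank_eq_one_of_kolyvaginSystem_of_exists_isNewformOf
    (hmod : ModularForms.exists_isNewformOf) (hHL : HoffsteinLuo1997_exists_twist_L_one_ne_zero)
    (hMM : murtyMurty_exists_heegnerField_twist_simpleZero_of_rootNumber_eq_one)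
    (hGZK : rank_eq_analyticRank_of_analyticRank_le_one)
    (hDD : dokchitser_selmerCorank_baseChange_mod_two_eq)
    (hK1 : BurungaleEtAl2026_exists_kolyvaginClass_ne_zero)
    (hK2 : Kolyvagin1991_selmerCorank_of_kolyvaginClass_ne_zero)
    (hGZ : ∀ (N : ℕ) [NeZero N] (W : WeierstrassCurve ℚ) (K : Type) [Field K] [NumberField K],
      gross_zagier N W K)
    (hrec : ∀ (N : ℕ) [NeZero N] (W : WeierstrassCurve ℚ) (K : Type) [Field K] [NumberField K],
      heegnerPointOfConductor_one_galoisConj N W K) :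
    yanZhu_analyticRank_eq_one_of_selmerCorank_eq_one := by
  intro W _ _ p _ hp5 hgood hord hsurj hcorank
  exact yanZhu_analyticRank_eq_one_of_selmerCorank_eq_one_of_kolyvaginSystem_of_rootNumber_eq_neg_one
    hmod hHL (fun W _ p _ ↦ kato_finite_of_L_one_ne_zero_of_rank_eq_analyticRank W p hGZK) hK1 hK2
    (fun W N _ K _ _ ↦
      analyticRankEK_eq_one_iff_heegner_nonTorsion_of_exists_isNewformOf W N K (hGZ N W K) hmod)
    hrec W p hp5 hgood hord hsurj
    (rootNumber_eq_neg_one_of_selmerCorank_eq_one_of_facts hmod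
      (waldspurger_exists_heegnerField_twist_ne_zero_of_hoffsteinLuo hmod hHL) hMM hGZK hDD W p
      (by omega) hcorank)
    hcorank

end Literature.NumberTheory.EllipticCurves

end
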